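import Mathlib
import HarnessLib
import Summits.CriticalPhenomena.SAWScalingLimit.Theses.SAWDevelopingMap
import Literature.Probability.RandomPlanarGeometry.HexDomainSingleton
import Literature.Barriers.CriticalPhenomena.ParafermionicHalfCauchyRiemann

/-!
# Line `z3-covariant-fixed-point` — skeleton for crux `InteriorFlattening`
(stmt-CriticalPhenomena-8297, route `SAWDevelopingMap`, rank 3)

The crux `(M)`: for every `ε > 0` there is a depth `R` such that at every vertex `v` of every
simply connected hexagonal domain `Λ` whose Euclidean `R`-ball of lattice vertices lies in `Λ`,
for every boundary root `a` and every labelling `w₀ w₁ w₂` of the three neighbours of `v`, the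
DCS observable `F = F(a, ·, x_c, 5/8)` satisfies `‖F₀ + ωF₁ + ω²F₂‖ ≤ ε ‖F₀ + F₁ + F₂‖`
(`ω = e^{2πi/3}`; for the ccw labelling the left side is `0` by DCS Lemma 1, for the cw one it
is the Beltrami mode `B`, the right side is the monopole `M`).

THE LINE (idea `z3-covariant-fixed-point`, ideator 3, round 1; the card text itself was not
reachable from this seat — see `Lines/z3-covariant-fixed-point.md`, "Provenance" — so the line is
rebuilt from its title, the three TRIAGE-r1 necessary conditions and the crux's Disproof notes):
the depth profile of the Beltrami RATIO is the fixed point of a `ℤ/3`-covariant contraction.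

* OBJECT. `DepthRatioBound R η` := the crux's inequality with `ε` replaced by `η` at depth `R`
  (uniform in `(Λ, a, v, labelling)`; non-increasing in `R`). The crux is
  `∀ ε > 0, ∃ R, DepthRatioBound R ε`.
* EXACT STEP (stub `stub_lastEntranceRecursion`, identities + triangle inequalities, provable
  now). Stop every walk `a → star(v)` at its LAST ENTRANCE into the lattice ball `B_s(v)`
  (`s ≤ R/2`): the tail lives in the PICTURE DOMAIN `B_s(v) ∖ P`, `P` = (vertices of the prefix
  inside `B_s(v)`, entrance dart) — simply connected, rooted at the dart, and carried to another
  picture domain by the `120°` rotation `ρ` about `c_v`. So `B(Λ,a,v) = Σ_P A(P) b(P)` and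
  `M = Σ_P A(P) m(P)` with complex PREFIX AMPLITUDES `A(P)` (far field, never expanded) and INNER
  modes `b, m` of the picture domains; inner covariance `m(ρP) = m(P)`, `b(ρP) = ω̄ b(P)` (cw)
  regroups each `ℤ/3`-orbit: `B = Σ_O b(P_O) · Â_O(ω̄)`, `M = Σ_O m(P_O) · Â_O(1)` with the
  orbit characters `Â_O(χ) = Σ_{k<3} χ^k A(ρ^k P_O)`. Inserting the ratio bound at the inner
  depth `t` for pictures that stay out of `B_t(v)` and the crude bound `‖b‖ ≤ mass` for the
  others: `‖B‖ ≤ η(t) · TwAll(s) + ShNum(s,t)`.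
* CONTRACTION (stub `stub_orbitTwistDecay`, the `ℤ/3` lever, HARDEST): the `|m|`-weighted
  twisted orbit characters are small against the plain ones once the prefix has crossed the
  clean lattice annulus `A(s, m₀ s) ⊆ Λ`: `∀ δ > 0 ∃ m₀: TwAll(s) ≤ δ · PlDen(s)` at depth
  `R ≥ m₀ s` — the lifted entrance-rotation law of an orbit spreads over the three rotations (and
  sheets), its residual anisotropy is conformal-dipole small `(s/R)`, and the `ω̄`-character sits
  at spin `13/8 ≡ −11/8` whose Gaussian factor decays faster than the monopole's `5/8` (the slow
  spin `−3/8` channel is the `ω`-character = the DCS mode, killed by Lemma 1 — this is where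
  `ℤ/3` covariance and Lemma 1 do the work; predicted ratio `≍ m₀^{-2/3}`).
* COHERENCE (stub `stub_monopoleCoherence`, the simple-connectivity lever): no destructive
  interference of the monopole ACROSS orbits, `PlDen(s) ≤ K ‖M‖` — the triagers' requested
  amplification bound `Σ_O |m_O| |Â_O(1)| ≤ (K/3) |Σ_O m_O Â_O(1)|`; false with holes
  (two-corridor fold, Disproof §c, `noFoldBound_false_without_simplyConnected`); at the heuristic
  level it says the monopole at an `R`-deep vertex keeps its natural size uniformly over simply
  connected far fields (Koebe distortion for `(φ′)^{5/8}`).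
* INTRUSION TAIL (stub `stub_intrusionTail`): prefixes that dived into `B_{√s}(v)` before their
  last entrance are `3`-arm rare, beating the crude-bound loss:
  `∀ δ > 0: ShNum(s, √s) ≤ δ · PlDen(s)` for `s ≥ s₁(δ)` (predicted `s^{-3/4+25/48} = s^{-11/48}`).
* BASE (stub `stub_baseDistortion`): some finite ratio bound at some depth (eventual bounded
  distortion in the bulk; implied by the sibling crux `NoFoldBound`, strictly weaker).
* FIXED POINT (PROVED here, `profile_decay`): a depth-monotone bound predicate with a finite base
  and, for every `δ > 0`, the step `D (√(R/m₀)) η → D R (q η + δ)` beyond `R₁(δ)`,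
  `q = K/(2(K+1)) < 1`, is eventually below every `ε` — the unique fixed point of the affine
  contraction is `0`.

Composition `InteriorFlattening_of : S1 → S2 → S3 → S4 → S5 → InteriorFlattening` is proved below
(no `sorry` outside the five `stub_*`).

Disproof honoured (cdisprove notes (a)–(i) on the item; `Disproof.lean` itself is not mounted in
this jail): (a) the depth hypothesis is used in S1 (`ball Λ v s` is the full, rotation-invariant
lattice ball only because `B_R(v) ⊆ Λ`, and inner picture domains are `t`-deep) — so no stub is an
instance of `interiorFlattening_false_without_depth`; (b) every bound is uniform in `(Λ,a,v)`
(`DepthRatioBound` quantifies inside); (c) simple connectivity is a hypothesis of S2/S3 and is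
load-bearing there (interferometric far fields); (f) no port equalisation is claimed anywhere;
(i) all labellings are covered, the ccw class being `0` by Lemma 1 inside S1.
-/

namespace Summit.CriticalPhenomena.SAWScalingLimit.Cruxes.InteriorFlattening.Z3CovariantFixedPoint

open scoped BigOperators ComplexConjugate Classical
open Literature.Probability.LatticeModels Literature.Probability.RandomPlanarGeometry.SAW

noncomputable section

/-! ### The objects of the crux -/

/-- `x_c = 1/√(2+√2)`. -/
abbrev xc : ℝ := hexCriticalFugacity

/-- `ω = e^{2πi/3}` (literally the crux's `ω`). -/
def omega : ℂ := Complex.exp (2 * Real.pi * Complex.I / 3)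

/-- The DCS observable at `(x_c, 5/8)` (literally the crux's `F`). -/
def obs (Λ : Finset HexVertex) (a z : Sym2 HexVertex) : ℂ :=
  hexParafermionicObservable Λ a xc (5 / 8) z

/-- The MONOPOLE (sum mode) `M = F₀ + F₁ + F₂` at `v` — the crux's right-hand side. -/
def mono (Λ : Finset HexVertex) (a : Sym2 HexVertex) (v w₀ w₁ w₂ : HexVertex) : ℂ :=
  obs Λ a s(v, w₀) + obs Λ a s(v, w₁) + obs Λ a s(v, w₂)

/-- The `ω`-COMBINATION `F₀ + ωF₁ + ω²F₂` at `v` — the crux's left-hand side (the Beltrami mode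
for cw labellings, `0` for ccw ones by DCS Lemma 1). -/
def belt (Λ : Finset HexVertex) (a : Sym2 HexVertex) (v w₀ w₁ w₂ : HexVertex) : ℂ :=
  obs Λ a s(v, w₀) + omega * obs Λ a s(v, w₁) + omega ^ 2 * obs Λ a s(v, w₂)

/-- The positive MASS `Σ_i Σ_{γ : a → {v,w_i}} x_c^{ℓ(γ)}` at `v` (spin `0`). -/
def mass (Λ : Finset HexVertex) (a : Sym2 HexVertex) (v w₀ w₁ w₂ : HexVertex) : ℝ :=
  ‖hexParafermionicObservable Λ a xc 0 s(v, w₀)‖ + ‖hexParafermionicObservable Λ a xc 0 s(v, w₁)‖ +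
    ‖hexParafermionicObservable Λ a xc 0 s(v, w₂)‖

/-- `v` is `R`-deep in `Λ` (literally the crux's ball hypothesis). -/
def Deep (Λ : Finset HexVertex) (v : HexVertex) (R : ℝ) : Prop :=
  ∀ w : HexVertex, dist (hexCenter w) (hexCenter v) ≤ R → w ∈ Λ

/-- **The profile predicate.** `DepthRatioBound R η`: at depth `R` the crux's quotient is at most
`η`, uniformly over simply connected `Λ`, boundary roots `a`, `R`-deep vertices `v` and
labellings. The crux is `∀ ε > 0, ∃ R, DepthRatioBound R ε` (`interiorFlattening_of_bounds`). -/
def DepthRatioBound (R η : ℝ) : Prop :=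
  ∀ (Λ : Finset HexVertex), hexDomainSimplyConnected Λ → ∀ a ∈ hexDomainBoundary Λ, ∀ v ∈ Λ,
    Deep Λ v R → ∀ w₀ w₁ w₂ : HexVertex, hexGraph.Adj v w₀ → hexGraph.Adj v w₁ → hexGraph.Adj v w₂ →
      w₀ ≠ w₁ → w₁ ≠ w₂ → w₀ ≠ w₂ → ‖belt Λ a v w₀ w₁ w₂‖ ≤ η * ‖mono Λ a v w₀ w₁ w₂‖

/-! ### Last-entrance prefixes, pictures, picture domains, the `ℤ/3` action -/

/-- The lattice ball of radius `s` about `c_v`, cut out of `Λ` (the FULL lattice ball as soon as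
`v` is `s`-deep — the only way the depth hypothesis enters). -/
def ball (Λ : Finset HexVertex) (v : HexVertex) (s : ℝ) : Finset HexVertex :=
  Λ.filter (fun q => dist (hexCenter q) (hexCenter v) ≤ s)

/-- `ψ : a → s(y,z)` is a LAST-ENTRANCE PREFIX into `B_s(v)`: its vertex list ends at `y`, which
lies outside the ball, and the dart `y → z` enters the ball. Earlier visits of `ψ` to the ball
are allowed (they are recorded by the picture); the continuation stays inside `B_s(v)`. -/
def IsLastEntrance (v : HexVertex) (s : ℝ) (y z : HexVertex) {Λ : Finset HexVertex}
    {a : Sym2 HexVertex} (ψ : HexMidEdgeSAW Λ a s(y, z)) : Prop :=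
  ψ.verts.getLast? = some y ∧ hexGraph.Adj y z ∧ s < dist (hexCenter y) (hexCenter v) ∧
    dist (hexCenter z) (hexCenter v) ≤ s

/-- A PICTURE: a vertex set inside the ball (the prefix's earlier intrusions) and the entrance
dart `(y, z)`. -/
abbrev Picture : Type := Finset HexVertex × HexVertex × HexVertex

/-- The picture of a prefix at scale `s`. -/
def lpic (v : HexVertex) (s : ℝ) (y z : HexVertex) {Λ : Finset HexVertex} {a : Sym2 HexVertex}
    (ψ : HexMidEdgeSAW Λ a s(y, z)) : Picture :=
  (ψ.verts.toFinset.filter (fun q => dist (hexCenter q) (hexCenter v) ≤ s), y, z)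

/-- The PICTURE DOMAIN `B_s(v) ∖ P`: the continuations after the last entrance are exactly the
walks of this domain from the root mid-edge `s(P.2.1, P.2.2)` to `star(v)`. It is simply
connected (every intrusion arc hangs on the outside of the ball) and `t`-deep at `v` when the
picture avoids `B_t(v)`. -/
def picDom (Λ : Finset HexVertex) (v : HexVertex) (s : ℝ) (P : Picture) : Finset HexVertex :=
  ball Λ v s \ P.1

/-- The root mid-edge of a picture (its entrance dart). -/
def picRoot (P : Picture) : Sym2 HexVertex := s(P.2.1, P.2.2)

/-- Inner monopole `m(P)` of the picture domain. -/
def innerMono (Λ : Finset HexVertex) (v : HexVertex) (s : ℝ) (P : Picture) (w₀ w₁ w₂ : HexVertex) : ℂ :=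
  mono (picDom Λ v s P) (picRoot P) v w₀ w₁ w₂

/-- Inner `ω`-combination `b(P)` of the picture domain. -/
def innerBelt (Λ : Finset HexVertex) (v : HexVertex) (s : ℝ) (P : Picture) (w₀ w₁ w₂ : HexVertex) : ℂ :=
  belt (picDom Λ v s P) (picRoot P) v w₀ w₁ w₂

/-- Inner positive mass of the picture domain (crude bound `‖b(P)‖ ≤ innerMass`). -/
def innerMass (Λ : Finset HexVertex) (v : HexVertex) (s : ℝ) (P : Picture) (w₀ w₁ w₂ : HexVertex) : ℝ :=
  mass (picDom Λ v s P) (picRoot P) v w₀ w₁ w₂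

/-- PREFIX AMPLITUDE of a picture: `A(P) = Σ_{ψ : lpic ψ = P} e^{-iσW(ψ)} x_c^{|ψ|}` over the
last-entrance prefixes from the root `a` (darts range over `Λ × Λ`; non-prefixes contribute `0`).
This is the far field; it is never expanded by a triangle inequality. -/
def picAmp (Λ : Finset HexVertex) (a : Sym2 HexVertex) (v : HexVertex) (s : ℝ) (P : Picture) : ℂ :=
  ∑ p ∈ Λ ×ˢ Λ, ∑ ψ : HexMidEdgeSAW Λ a s(p.1, p.2),
    if IsLastEntrance v s p.1 p.2 ψ ∧ lpic v s p.1 p.2 ψ = P then ψ.weight xc (5 / 8) else 0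

/-- Rotation by `+120°` about the centre of `v`: the lattice vertex whose centre is
`c_v + ζ² (c_y - c_v)` (`ζ = e^{iπ/3}`, `ζ² = ω`; a symmetry of the honeycomb fixing `v`, so the
witness exists and is unique; explicitly `rot3 (x,k) (p,k') = (R²(p-x) + x + (k-k')e₀, k')` with
`R²(m,n) = (-(m+n), m)`). -/
def rot3 (v y : HexVertex) : HexVertex :=
  Classical.epsilon fun y' : HexVertex =>
    hexCenter y' - hexCenter v = triZeta ^ 2 * (hexCenter y - hexCenter v)

/-- The `ℤ/3` action on pictures. -/
def rotPic (v : HexVertex) (P : Picture) : Picture :=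
  (P.1.image (rot3 v), rot3 v P.2.1, rot3 v P.2.2)

/-- PLAIN orbit character `|Â_O(1)| = |Σ_{k<3} A(ρ^k P)|` of the orbit of `P` (couples to the inner
monopole, which is rotation invariant). -/
def plainAmp (Λ : Finset HexVertex) (a : Sym2 HexVertex) (v : HexVertex) (s : ℝ) (P : Picture) : ℝ :=
  ‖∑ k ∈ Finset.range 3, picAmp Λ a v s ((rotPic v)^[k] P)‖

/-- TWISTED orbit character `|Â_O(ω̄)| = |Σ_{k<3} ω̄^k A(ρ^k P)|` (couples to the inner cw Beltrami
mode, `b(ρP) = ω̄ b(P)`; spin `13/8 ≡ -11/8`). The `ω`-twist (spin `-3/8`, the large channel)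
couples only to the DCS mode, which Lemma 1 kills — it never appears. -/
def twistAmp (Λ : Finset HexVertex) (a : Sym2 HexVertex) (v : HexVertex) (s : ℝ) (P : Picture) : ℝ :=
  ‖∑ k ∈ Finset.range 3, (starRingEnd ℂ omega) ^ k * picAmp Λ a v s ((rotPic v)^[k] P)‖

/-- A picture is `t`-DEEP when its intrusion set avoids the ball `B_t(v)` (then `v` is `t`-deep
in the picture domain). Rotation invariant. -/
def DeepPic (v : HexVertex) (t : ℝ) (P : Picture) : Prop :=
  ∀ q ∈ P.1, t < dist (hexCenter q) (hexCenter v)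

/-- The finite index set of pictures at scale `s` (intrusions inside `B_s`, dart tail within
`s + 1`, dart head inside `B_s`); rotation invariant once `B_{s+1}(v) ⊆ Λ`; unrealised pictures
have amplitude `0`. -/
def picSet (Λ : Finset HexVertex) (v : HexVertex) (s : ℝ) : Finset Picture :=
  (ball Λ v s).powerset ×ˢ (ball Λ v (s + 1) ×ˢ ball Λ v s)

/-! ### The three functionals of the recursion -/

/-- `TwAll(s) = Σ_P |m(P)| · |Â_P(ω̄)|` — twisted characters weighted by inner monopoles. -/
def TwAll (Λ : Finset HexVertex) (a : Sym2 HexVertex) (v : HexVertex) (s : ℝ) (w₀ w₁ w₂ : HexVertex) : ℝ :=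
  ∑ P ∈ picSet Λ v s, ‖innerMono Λ v s P w₀ w₁ w₂‖ * twistAmp Λ a v s P

/-- `PlDen(s) = Σ_P |m(P)| · |Â_P(1)|` — plain characters weighted by inner monopoles
(`= 3 Σ_orbits |m_O| |Â_O(1)|`, to be compared with `|M| = |Σ_O m_O Â_O(1)|`). -/
def PlDen (Λ : Finset HexVertex) (a : Sym2 HexVertex) (v : HexVertex) (s : ℝ) (w₀ w₁ w₂ : HexVertex) : ℝ :=
  ∑ P ∈ picSet Λ v s, ‖innerMono Λ v s P w₀ w₁ w₂‖ * plainAmp Λ a v s P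

/-- `ShNum(s,t) = Σ_{P not t-deep} innerMass(P) · |Â_P(ω̄)|` — the intrusion tail, paid crudely. -/
def ShNum (Λ : Finset HexVertex) (a : Sym2 HexVertex) (v : HexVertex) (s t : ℝ) (w₀ w₁ w₂ : HexVertex) : ℝ :=
  ∑ P ∈ picSet Λ v s, if DeepPic v t P then 0 else innerMass Λ v s P w₀ w₁ w₂ * twistAmp Λ a v s P

/-! ### The five statements of the line, as named propositions -/

/-- **S1 statement — the last-entrance recursion (exact identities + triangle inequalities).** -/
def LastEntranceRecursion : Prop :=
  ∀ (R s t η : ℝ), 1 ≤ t → t ≤ s → 2 * s ≤ R → 0 ≤ η → DepthRatioBound t η →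
    ∀ (Λ : Finset HexVertex), hexDomainSimplyConnected Λ → ∀ a ∈ hexDomainBoundary Λ, ∀ v ∈ Λ,
      Deep Λ v R → ∀ w₀ w₁ w₂ : HexVertex, hexGraph.Adj v w₀ → hexGraph.Adj v w₁ →
        hexGraph.Adj v w₂ → w₀ ≠ w₁ → w₁ ≠ w₂ → w₀ ≠ w₂ →
          ‖belt Λ a v w₀ w₁ w₂‖ ≤ η * TwAll Λ a v s w₀ w₁ w₂ + ShNum Λ a v s t w₀ w₁ w₂

/-- **S2 statement — orbit twist decay (the `ℤ/3` lever).** -/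
def OrbitTwistDecay : Prop :=
  ∀ δ : ℝ, 0 < δ → ∃ m₀ s₀ : ℝ, 2 ≤ m₀ ∧ 1 ≤ s₀ ∧
    ∀ (Λ : Finset HexVertex), hexDomainSimplyConnected Λ → ∀ a ∈ hexDomainBoundary Λ, ∀ v ∈ Λ,
      ∀ R s : ℝ, Deep Λ v R → s₀ ≤ s → m₀ * s ≤ R →
        ∀ w₀ w₁ w₂ : HexVertex, hexGraph.Adj v w₀ → hexGraph.Adj v w₁ → hexGraph.Adj v w₂ →
          w₀ ≠ w₁ → w₁ ≠ w₂ → w₀ ≠ w₂ →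
            TwAll Λ a v s w₀ w₁ w₂ ≤ δ * PlDen Λ a v s w₀ w₁ w₂

/-- **S3 statement — monopole coherence across orbits (the simple-connectivity lever).** -/
def MonopoleCoherence : Prop :=
  ∃ K s₀ : ℝ, 0 ≤ K ∧ 1 ≤ s₀ ∧
    ∀ (Λ : Finset HexVertex), hexDomainSimplyConnected Λ → ∀ a ∈ hexDomainBoundary Λ, ∀ v ∈ Λ,
      ∀ R s : ℝ, Deep Λ v R → s₀ ≤ s → 2 * s ≤ R →
        ∀ w₀ w₁ w₂ : HexVertex, hexGraph.Adj v w₀ → hexGraph.Adj v w₁ → hexGraph.Adj v w₂ →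
          w₀ ≠ w₁ → w₁ ≠ w₂ → w₀ ≠ w₂ →
            PlDen Λ a v s w₀ w₁ w₂ ≤ K * ‖mono Λ a v w₀ w₁ w₂‖

/-- **S4 statement — the intrusion tail at `t = √s`.** -/
def IntrusionTail : Prop :=
  ∀ δ : ℝ, 0 < δ → ∃ s₁ : ℝ, 1 ≤ s₁ ∧
    ∀ (Λ : Finset HexVertex), hexDomainSimplyConnected Λ → ∀ a ∈ hexDomainBoundary Λ, ∀ v ∈ Λ,
      ∀ R s : ℝ, Deep Λ v R → s₁ ≤ s → 2 * s ≤ R →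
        ∀ w₀ w₁ w₂ : HexVertex, hexGraph.Adj v w₀ → hexGraph.Adj v w₁ → hexGraph.Adj v w₂ →
          w₀ ≠ w₁ → w₁ ≠ w₂ → w₀ ≠ w₂ →
            ShNum Λ a v s (Real.sqrt s) w₀ w₁ w₂ ≤ δ * PlDen Λ a v s w₀ w₁ w₂

/-- **S5 statement — a finite distortion bound at some depth (the base of the iteration).** -/
def BaseDistortion : Prop :=
  ∃ Rb Kb : ℝ, 0 ≤ Kb ∧ DepthRatioBound Rb Kb

/-! ### The stubs (registered; signatures spelled out, definitionally the named statements) -/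

/-- **S1 — the last-entrance recursion.** For `1 ≤ t ≤ s`, `2s ≤ R` and a ratio bound `η` valid
at depth `t`: at every `R`-deep vertex, `‖B‖ ≤ η · TwAll(s) + ShNum(s,t)`. Ingredients (all
finite identities or triangle inequalities): the last-entrance bijection
`γ ↦ (ψ, γ_in)` (weights multiply, windings add at the junction mid-edge, lengths add; `γ_in`
ranges over `HexMidEdgeSAW (picDom Λ v s P) (picRoot P) s(v, w_i)`), hence
`belt = Σ_{P ∈ picSet} A(P) · innerBelt(P)`; the lattice rotation `rot3 v` (graph automorphism
fixing `v`, preserving `ball`, lengths and windings) giving `innerMono (ρP) = innerMono P` and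
`innerBelt (ρP) = ω̄ · innerBelt P` for cw labellings (for ccw ones `belt ≡ 0` and
`innerBelt ≡ 0` by `DuminilCopinSmirnov2012_lemma1_holds`); orbit regrouping over the bijection
`rotPic v` of `picSet` (needs `B_{s+1}(v) ⊆ Λ`): `|belt| ≤ (1/3) Σ_P |innerBelt P| · twistAmp P`;
then `|innerBelt P| ≤ η |innerMono P|` for `t`-deep pictures (the picture domain is simply
connected, rooted at its dart, `t`-deep at `v` — or the term is `0` when the dart head was
visited) and `|innerBelt P| ≤ innerMass P` otherwise (`norm_hexParafermionicObservable_le`). -/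
theorem stub_lastEntranceRecursion :
    ∀ (R s t η : ℝ), 1 ≤ t → t ≤ s → 2 * s ≤ R → 0 ≤ η → DepthRatioBound t η →
      ∀ (Λ : Finset HexVertex), hexDomainSimplyConnected Λ → ∀ a ∈ hexDomainBoundary Λ, ∀ v ∈ Λ,
        Deep Λ v R → ∀ w₀ w₁ w₂ : HexVertex, hexGraph.Adj v w₀ → hexGraph.Adj v w₁ →
          hexGraph.Adj v w₂ → w₀ ≠ w₁ → w₁ ≠ w₂ → w₀ ≠ w₂ →
            ‖belt Λ a v w₀ w₁ w₂‖ ≤ η * TwAll Λ a v s w₀ w₁ w₂ + ShNum Λ a v s t w₀ w₁ w₂ := by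
  sorry

/-- **S2 — orbit twist decay (HARDEST).** For every `δ > 0` there are a scale ratio `m₀ ≥ 2` and
a scale `s₀` such that for every admissible configuration at depth `R ≥ m₀ s`, `s ≥ s₀`:
`TwAll(s) ≤ δ · PlDen(s)` — averaged against the inner monopoles, the `ω̄`-twisted orbit
character of the lifted entrance-rotation law of the last-entrance prefixes is small against the
plain one once the prefixes have crossed the clean lattice annulus `A(s, m₀ s) ⊆ Λ`. Mechanism:
spread over the three rotations and the sheets (Poisson: the plain character is the
`5/8`-transform, the `ω̄`-twisted one the `13/8 ≡ -11/8`-transform of the lifted law), plus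
conformal-dipole anisotropy `(s/R)` feeding the `-3/8`-alias; prediction for the ratio at scale
ratio `m`: `≍ m^{-(1+3/16-25/48)} = m^{-2/3}` (KM numerics on the item: `|μ| ∝ R^{-0.6}`). Simple
connectivity is load-bearing: a far field with two access routes can null the plain character
orbit by orbit (Disproof §c). (For fixed `s`, the supremum of `TwAll/PlDen` over `R`-deep
configurations is non-increasing in `R`, so "`R ≥ m₀ s`" asks nothing beyond "`R = m₀ s`".) -/
theorem stub_orbitTwistDecay :
    ∀ δ : ℝ, 0 < δ → ∃ m₀ s₀ : ℝ, 2 ≤ m₀ ∧ 1 ≤ s₀ ∧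
      ∀ (Λ : Finset HexVertex), hexDomainSimplyConnected Λ → ∀ a ∈ hexDomainBoundary Λ, ∀ v ∈ Λ,
        ∀ R s : ℝ, Deep Λ v R → s₀ ≤ s → m₀ * s ≤ R →
          ∀ w₀ w₁ w₂ : HexVertex, hexGraph.Adj v w₀ → hexGraph.Adj v w₁ → hexGraph.Adj v w₂ →
            w₀ ≠ w₁ → w₁ ≠ w₂ → w₀ ≠ w₂ →
              TwAll Λ a v s w₀ w₁ w₂ ≤ δ * PlDen Λ a v s w₀ w₁ w₂ := by
  sorry

/-- **S3 — monopole coherence across orbits.** There is `K` such that for every admissible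
configuration at depth `R` and `s ∈ [s₀, R/2]`, `PlDen(s) ≤ K ‖M‖`, i.e.
`Σ_O |m_O| |Â_O(1)| ≤ (K/3) |Σ_O m_O Â_O(1)|`: the complex numbers `m_O Â_O(1)` (phase =
`σ ×` conditional mean TOTAL winding given the orbit) do not cancel across orbits. This is the
amplification bound the triage asked to be named; it is where "no interferometer inside a simply
connected domain" enters (kit j005678: 108 adversarial far fields, no amplification; two
corridors with a hole give `|μ| = 1.49`). -/
theorem stub_monopoleCoherence :
    ∃ K s₀ : ℝ, 0 ≤ K ∧ 1 ≤ s₀ ∧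
      ∀ (Λ : Finset HexVertex), hexDomainSimplyConnected Λ → ∀ a ∈ hexDomainBoundary Λ, ∀ v ∈ Λ,
        ∀ R s : ℝ, Deep Λ v R → s₀ ≤ s → 2 * s ≤ R →
          ∀ w₀ w₁ w₂ : HexVertex, hexGraph.Adj v w₀ → hexGraph.Adj v w₁ → hexGraph.Adj v w₂ →
            w₀ ≠ w₁ → w₁ ≠ w₂ → w₀ ≠ w₂ →
              PlDen Λ a v s w₀ w₁ w₂ ≤ K * ‖mono Λ a v w₀ w₁ w₂‖ := by
  sorry

/-- **S4 — the intrusion tail.** For every `δ > 0` there is `s₁` such that for every admissible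
configuration and every picture scale `s ∈ [s₁, R/2]`, the pictures whose intrusion set meets
`B_{√s}(v)` — prefixes that dived to depth `√s` and came back out of `B_s(v)` before their last
entrance — carry a share `ShNum(s, √s) ≤ δ · PlDen(s)`. Mechanism: three SAW strands meet in
`B_{√s}(v)` (dive in, dive out, final approach) against one for a typical walk — predicted cost
`(√s/s)^{x₃-x₁} = s^{-3/4}` (`x_L = (9L²-4)/48`) — which beats the loss `mass/|m| ≍ s^{25/48}`
of the crude bound: ratio `≍ s^{-11/48} → 0`. (Any `t = s^θ` with `25/72 < θ < 1` would do; S1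
is stated for general `t`.) A statement about the walk law weighted by the orbit characters. -/
theorem stub_intrusionTail :
    ∀ δ : ℝ, 0 < δ → ∃ s₁ : ℝ, 1 ≤ s₁ ∧
      ∀ (Λ : Finset HexVertex), hexDomainSimplyConnected Λ → ∀ a ∈ hexDomainBoundary Λ, ∀ v ∈ Λ,
        ∀ R s : ℝ, Deep Λ v R → s₁ ≤ s → 2 * s ≤ R →
          ∀ w₀ w₁ w₂ : HexVertex, hexGraph.Adj v w₀ → hexGraph.Adj v w₁ → hexGraph.Adj v w₂ →
            w₀ ≠ w₁ → w₁ ≠ w₂ → w₀ ≠ w₂ →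
              ShNum Λ a v s (Real.sqrt s) w₀ w₁ w₂ ≤ δ * PlDen Λ a v s w₀ w₁ w₂ := by
  sorry

/-- **S5 — base: eventual bounded distortion in the bulk.** Some finite ratio bound holds at some
depth: `∃ R_b K_b, DepthRatioBound R_b K_b`. Strictly weaker than the sibling crux `NoFoldBound`
(which gives it at every depth with `K_b = k < 1`); needed because the contraction acts on a
finite profile (a fold of unbounded ratio deep inside would be a fixed point at `∞`). -/
theorem stub_baseDistortion :
    ∃ Rb Kb : ℝ, 0 ≤ Kb ∧ DepthRatioBound Rb Kb := by
  sorry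

/-! ### Consistency: each named statement IS its registered stub (definitionally) -/

theorem lastEntranceRecursion_holds : LastEntranceRecursion := stub_lastEntranceRecursion
theorem orbitTwistDecay_holds : OrbitTwistDecay := stub_orbitTwistDecay
theorem monopoleCoherence_holds : MonopoleCoherence := stub_monopoleCoherence
theorem intrusionTail_holds : IntrusionTail := stub_intrusionTail
theorem baseDistortion_holds : BaseDistortion := stub_baseDistortion

/-! ### Name-keyed aliases of the five statements (the hypotheses of the composition) -/
namespace Registered

/-- Alias of `LastEntranceRecursion` keyed by the registered stub name. -/
abbrev stub_lastEntranceRecursion : Prop := LastEntranceRecursion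
/-- Alias of `OrbitTwistDecay` keyed by the registered stub name. -/
abbrev stub_orbitTwistDecay : Prop := OrbitTwistDecay
/-- Alias of `MonopoleCoherence` keyed by the registered stub name. -/
abbrev stub_monopoleCoherence : Prop := MonopoleCoherence
/-- Alias of `IntrusionTail` keyed by the registered stub name. -/
abbrev stub_intrusionTail : Prop := IntrusionTail
/-- Alias of `BaseDistortion` keyed by the registered stub name. -/
abbrev stub_baseDistortion : Prop := BaseDistortion

end Registered

/-! ### Proved glue: monotonicity, nonnegativity, the crux from profile bounds -/

/-- Deeper configurations satisfy shallower depth bounds. -/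
theorem depthRatioBound_mono_R (R R' η : ℝ) (h : R ≤ R') (hD : DepthRatioBound R η) :
    DepthRatioBound R' η := by
  intro Λ hΛ a ha v hv hdeep
  exact hD Λ hΛ a ha v hv (fun y hy => hdeep y (hy.trans h))

/-- `DepthRatioBound` is monotone in the bound. -/
theorem depthRatioBound_mono_b (R η η' : ℝ) (h : η ≤ η') (hD : DepthRatioBound R η) :
    DepthRatioBound R η' := by
  intro Λ hΛ a ha v hv hdeep w₀ w₁ w₂ h₀ h₁ h₂ h01 h12 h02
  exact (hD Λ hΛ a ha v hv hdeep w₀ w₁ w₂ h₀ h₁ h₂ h01 h12 h02).trans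
    (mul_le_mul_of_nonneg_right h (norm_nonneg _))

theorem twAll_nonneg (Λ : Finset HexVertex) (a : Sym2 HexVertex) (v : HexVertex) (s : ℝ)
    (w₀ w₁ w₂ : HexVertex) : 0 ≤ TwAll Λ a v s w₀ w₁ w₂ :=
  Finset.sum_nonneg fun _ _ => mul_nonneg (norm_nonneg _) (norm_nonneg _)

theorem plDen_nonneg (Λ : Finset HexVertex) (a : Sym2 HexVertex) (v : HexVertex) (s : ℝ)
    (w₀ w₁ w₂ : HexVertex) : 0 ≤ PlDen Λ a v s w₀ w₁ w₂ :=
  Finset.sum_nonneg fun _ _ => mul_nonneg (norm_nonneg _) (norm_nonneg _)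

theorem mass_nonneg (Λ : Finset HexVertex) (a : Sym2 HexVertex) (v w₀ w₁ w₂ : HexVertex) :
    0 ≤ mass Λ a v w₀ w₁ w₂ :=
  add_nonneg (add_nonneg (norm_nonneg _) (norm_nonneg _)) (norm_nonneg _)

theorem shNum_nonneg (Λ : Finset HexVertex) (a : Sym2 HexVertex) (v : HexVertex) (s t : ℝ)
    (w₀ w₁ w₂ : HexVertex) : 0 ≤ ShNum Λ a v s t w₀ w₁ w₂ := by
  refine Finset.sum_nonneg fun P _ => ?_
  split_ifs
  · exact le_rfl
  · exact mul_nonneg (mass_nonneg _ _ _ _ _ _) (norm_nonneg _)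

/-- The crux from profile bounds: `(∀ ε > 0, ∃ R, DepthRatioBound R ε) → InteriorFlattening`
(the crux's `let`-bound `F`, `ω` are literally `obs`, `omega`). -/
theorem interiorFlattening_of_bounds (h : ∀ ε : ℝ, 0 < ε → ∃ R : ℝ, DepthRatioBound R ε) :
    Summit.CriticalPhenomena.SAWScalingLimit.Theses.SAWDevelopingMap.InteriorFlattening := by
  intro ε hε
  obtain ⟨R, hR⟩ := h ε hε
  refine ⟨R, ?_⟩
  intro Λ hΛ a ha v hv hdeep w₀ w₁ w₂ h₀ h₁ h₂ h01 h12 h02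
  exact hR Λ hΛ a ha v hv hdeep w₀ w₁ w₂ h₀ h₁ h₂ h01 h12 h02

/-! ### Proved: the fixed-point lemma (affine contraction on a depth-monotone profile) -/

/-- **The fixed point is `0`.** For a predicate `D R b` ("bound `b` holds at depth `R`") that is
monotone in `R` and in `b`, with a finite base `D R_b K_b`, a depth-shrink `g` with `g(R) → ∞`,
and for every `δ > 0` the affine step `D (g R) b → D R (q b + δ)` beyond some `R₁(δ)`
(`0 ≤ q < 1`): every `ε > 0` is eventually a valid bound. (Iterate with `δ = ε(1-q)/2`:
`b_{n+1} = q b_n + δ`, `b_n ≤ q^n K_b + ε/2`.) -/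
theorem profile_decay (D : ℝ → ℝ → Prop)
    (monoR : ∀ R R' b, R ≤ R' → D R b → D R' b)
    (monoB : ∀ R b b', b ≤ b' → D R b → D R b')
    {Rb Kb : ℝ} (hKb : 0 ≤ Kb) (base : D Rb Kb)
    {q : ℝ} (hq0 : 0 ≤ q) (hq1 : q < 1)
    (g : ℝ → ℝ) (hg : ∀ T : ℝ, ∃ S : ℝ, ∀ R, S ≤ R → T ≤ g R)
    (step : ∀ δ : ℝ, 0 < δ → ∃ R₁ : ℝ, ∀ R, R₁ ≤ R → ∀ b, 0 ≤ b → D (g R) b → D R (q * b + δ)) :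
    ∀ ε : ℝ, 0 < ε → ∃ R, D R ε := by
  intro ε hε
  have h1q : 0 < 1 - q := by linarith
  obtain ⟨R₁, hR₁⟩ := step (ε * (1 - q) / 2) (by positivity)
  have key : ∀ n : ℕ, ∃ R, D R (q ^ n * Kb + ε / 2) := by
    intro n
    induction n with
    | zero =>
      refine ⟨Rb, monoB _ _ _ ?_ base⟩
      rw [pow_zero, one_mul]
      linarith
    | succ n ih =>
      obtain ⟨Rn, hRn⟩ := ih
      obtain ⟨S', hS'⟩ := hg Rn
      set R : ℝ := max S' R₁ with hRdef
      have hRR₁ : R₁ ≤ R := le_max_right _ _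
      have hRS' : S' ≤ R := le_max_left _ _
      have hb0 : 0 ≤ q ^ n * Kb + ε / 2 := by positivity
      have hD : D (g R) (q ^ n * Kb + ε / 2) := monoR _ _ _ (hS' R hRS') hRn
      refine ⟨R, monoB _ _ _ ?_ (hR₁ R hRR₁ _ hb0 hD)⟩
      have : q * (q ^ n * Kb + ε / 2) + ε * (1 - q) / 2 = q ^ (n + 1) * Kb + ε / 2 := by ring
      rw [this]
  obtain ⟨n, hn⟩ : ∃ n : ℕ, q ^ n * Kb ≤ ε / 2 := by
    by_cases hK : Kb = 0
    · exact ⟨0, by rw [hK, mul_zero]; linarith⟩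
    · have hKpos : 0 < Kb := lt_of_le_of_ne hKb (Ne.symm hK)
      obtain ⟨n, hn⟩ := exists_pow_lt_of_lt_one (div_pos (half_pos hε) hKpos) hq1
      exact ⟨n, ((lt_div_iff₀ hKpos).1 hn).le⟩
  obtain ⟨R, hR⟩ := key n
  exact ⟨R, monoB _ _ _ (by linarith) hR⟩

/-! ### Composition: the five stubs imply the crux BY NAME -/

/-- **The line concludes the crux.** Take `δ₂ = 1/(2(K+1))` in S2 (scale ratio `m₀`, so that the
contraction factor is `q = δ₂ K < 1/2`); at depth `R` use the picture scale `s = R/m₀` and the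
inner depth `t = √s`; S1 + S2 + S3 + S4 give the affine step `D (√(R/m₀)) b → D R (q b + δ)` for
every `δ > 0` beyond some `R₁(δ)`, S5 the base, `profile_decay` the limit. -/
theorem InteriorFlattening_of (h1 : Registered.stub_lastEntranceRecursion)
    (h2 : Registered.stub_orbitTwistDecay) (h3 : Registered.stub_monopoleCoherence)
    (h4 : Registered.stub_intrusionTail) (h5 : Registered.stub_baseDistortion) :
    Summit.CriticalPhenomena.SAWScalingLimit.Theses.SAWDevelopingMap.InteriorFlattening := by
  have hrec : LastEntranceRecursion := h1
  have hTwδ : OrbitTwistDecay := h2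
  have hShδ : IntrusionTail := h4
  obtain ⟨K, s₃, hK0, hs₃, hCoh⟩ := h3
  obtain ⟨Rb, Kb, hKb, hbase⟩ := h5
  have hK1 : 0 < K + 1 := by linarith
  -- the scale ratio m₀ ≥ 2 from S2 at δ₂ = 1/(2(K+1))
  obtain ⟨m₀, s₂, hm₀2, hs₂, hTw⟩ := hTwδ (1 / (2 * (K + 1))) (by positivity)
  have hm₀pos : 0 < m₀ := by linarith
  have hq0 : 0 ≤ 1 / (2 * (K + 1)) * K := by positivity
  have hq1 : 1 / (2 * (K + 1)) * K < 1 := by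
    rw [div_mul_eq_mul_div, one_mul, div_lt_one (by positivity)]
    linarith
  refine interiorFlattening_of_bounds
    (profile_decay DepthRatioBound depthRatioBound_mono_R depthRatioBound_mono_b hKb hbase
      hq0 hq1 (fun R => Real.sqrt (R / m₀)) ?_ ?_)
  · -- the depth shrink √(R/m₀) → ∞
    intro T
    refine ⟨m₀ * (max T 0) ^ 2, fun R hR => ?_⟩
    have hRs : (max T 0) ^ 2 ≤ R / m₀ := by
      rw [le_div_iff₀ hm₀pos]; linarith
    calc T ≤ max T 0 := le_max_left _ _
      _ = Real.sqrt ((max T 0) ^ 2) := (Real.sqrt_sq (le_max_right _ _)).symm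
      _ ≤ Real.sqrt (R / m₀) := Real.sqrt_le_sqrt hRs
  · -- the affine step beyond R₁(δ), with s = R/m₀ and t = √s
    intro δ hδ
    obtain ⟨s₄, hs₄, hSh⟩ := hShδ (δ / (K + 1)) (by positivity)
    set s₀ : ℝ := max (max s₂ s₃) (max s₄ 1) with hs₀def
    have hs₀₂ : s₂ ≤ s₀ := le_trans (le_max_left _ _) (le_max_left _ _)
    have hs₀₃ : s₃ ≤ s₀ := le_trans (le_max_right _ _) (le_max_left _ _)
    have hs₀₄ : s₄ ≤ s₀ := le_trans (le_max_left _ _) (le_max_right _ _)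
    have hs₀1 : 1 ≤ s₀ := le_trans (le_max_right _ _) (le_max_right _ _)
    refine ⟨m₀ * s₀, fun R hR b hb hD => ?_⟩
    set s : ℝ := R / m₀ with hsdef
    have hs₀s : s₀ ≤ s := by
      rw [hsdef, le_div_iff₀ hm₀pos]; linarith
    have hs1 : 1 ≤ s := hs₀1.trans hs₀s
    have hRpos : 0 < R := by
      have : 0 < m₀ * s₀ := mul_pos hm₀pos (by linarith)
      linarith
    have hms : m₀ * s ≤ R := by
      rw [hsdef, mul_div_cancel₀ R hm₀pos.ne']
    have h2s : 2 * s ≤ R :=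
      (mul_le_mul_of_nonneg_right hm₀2 (by linarith)).trans hms
    have ht1 : 1 ≤ Real.sqrt s := by
      rw [← Real.sqrt_one]; exact Real.sqrt_le_sqrt hs1
    have hts : Real.sqrt s ≤ s := by
      rw [Real.sqrt_le_left]
      · nlinarith
      · linarith
    intro Λ hΛ a ha v hv hdeep w₀ w₁ w₂ h₀ h₁ h₂ h01 h12 h02
    have H1 := hrec R s (Real.sqrt s) b ht1 hts h2s hb hD Λ hΛ a ha v hv hdeep w₀ w₁ w₂ h₀ h₁ h₂
      h01 h12 h02
    have H2 := hTw Λ hΛ a ha v hv R s hdeep (hs₀₂.trans hs₀s) hms w₀ w₁ w₂ h₀ h₁ h₂ h01 h12 h02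
    have H3 := hCoh Λ hΛ a ha v hv R s hdeep (hs₀₃.trans hs₀s) h2s w₀ w₁ w₂ h₀ h₁ h₂ h01 h12 h02
    have H4 := hSh Λ hΛ a ha v hv R s hdeep (hs₀₄.trans hs₀s) h2s w₀ w₁ w₂ h₀ h₁ h₂ h01 h12 h02
    have hPl := plDen_nonneg Λ a v s w₀ w₁ w₂
    have hM := norm_nonneg (mono Λ a v w₀ w₁ w₂)
    have hδK : δ / (K + 1) * K ≤ δ := by
      rw [div_mul_eq_mul_div, div_le_iff₀ hK1]
      nlinarith
    calc ‖belt Λ a v w₀ w₁ w₂‖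
        ≤ b * TwAll Λ a v s w₀ w₁ w₂ + ShNum Λ a v s (Real.sqrt s) w₀ w₁ w₂ := H1
      _ ≤ b * (1 / (2 * (K + 1)) * PlDen Λ a v s w₀ w₁ w₂) + δ / (K + 1) * PlDen Λ a v s w₀ w₁ w₂ :=
          add_le_add (mul_le_mul_of_nonneg_left H2 hb) H4
      _ = (b * (1 / (2 * (K + 1))) + δ / (K + 1)) * PlDen Λ a v s w₀ w₁ w₂ := by ring
      _ ≤ (b * (1 / (2 * (K + 1))) + δ / (K + 1)) * (K * ‖mono Λ a v w₀ w₁ w₂‖) :=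
          mul_le_mul_of_nonneg_left H3 (by positivity)
      _ = (1 / (2 * (K + 1)) * K * b + δ / (K + 1) * K) * ‖mono Λ a v w₀ w₁ w₂‖ := by ring
      _ ≤ (1 / (2 * (K + 1)) * K * b + δ) * ‖mono Λ a v w₀ w₁ w₂‖ :=
          mul_le_mul_of_nonneg_right (by linarith) hM

/-- Wiring check: the registered stubs feed `InteriorFlattening_of` as stated. -/
example : Summit.CriticalPhenomena.SAWScalingLimit.Theses.SAWDevelopingMap.InteriorFlattening :=
  InteriorFlattening_of stub_lastEntranceRecursion stub_orbitTwistDecay stub_monopoleCoherence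
    stub_intrusionTail stub_baseDistortion

end

end Summit.CriticalPhenomena.SAWScalingLimit.Cruxes.InteriorFlattening.Z3CovariantFixedPoint
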